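import Summits.QuantumFields.YangMills.Theorems.AllWindowsColdBoxBoxHighLineSmearedFPOrbit
import Summits.QuantumFields.YangMills.Theorems.AllWindowsColdBoxBoxHighLineSmearedFPWeight
import Summits.QuantumFields.YangMills.Theorems.AllWindowsColdBoxBoxHighLineLandauBallUniqueness

/-!
# T-S5.4ℓ `LandauBallCoercivity` — the QUANTITATIVE form of U3 (Gribov uniqueness ⇒ coercivity of the gauge-fixing functional on the
# gauge ball), typed verbatim from the planner's task and PROVED

Planner ym-idea-2 g17's typed task `Cruxes/BoxWindowHighSU2213/TaskS5Coercive.lean` (commit b39e5ac24203); STEP (1b) of the XL comparison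
stubs S5 (LINE-19 ⟨stmt-QuantumFields-24004⟩/⟨24335⟩) and U5 (LINE-20 ⟨24336⟩), FAR-REGION control of the smeared Faddeev–Popov integral
(`SHELL-BUDGET-S5U5.md`): on the gauge ball the Gaussian functional `landauPhi` of `W = U^{g'}` is bounded BELOW by `c·H⁻⁴·Σ_x gaugeDist g g' x`
whenever `V = U^{g}` is the Landau representative.  The Prop `LandauBallCoercivity` is copied VERBATIM; proved here:
**`landauBallCoercivity : LandauBallCoercivity`** with `c₀ = 1/32`, `c = 1/128`.

PROOF = the proof of ✓`stub_landauBallUniqueness` (…LandauBallUniqueness.lean) with «= 0» replaced by Cauchy–Schwarz.  With `h = g'·g⁻¹`,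
`ψ_x = q(h_x)` (`q = su2Quat`), `φ_x = Im ψ_x` (vanishing off the interior), `F_e = Im q(W_e) − Im q(V_e)`:
* U3 steps (1), (3), (4) verbatim: `Re ψ_x ≥ 7/8` (✓`norm_sub_one_le_of_edges`, ✓`one_sub_norm_le_re`), the per-edge bound
  ✓`edge_pairing_lower_sq`, edge multiplicity ✓`sum_edges_endpoints_le` and Poincaré ✓`sum_norm_sq_le_poincare` give
  `(5/8)D − 32r²S ≤ P := Σ_{e∈box} ⟪φ_x − φ_y, F_e⟫`, `S ≤ 4H²D`, `32r²S ≤ D/8` (`D = Σ_e ‖φ_x − φ_y‖²`, `S = Σ_x ‖φ_x‖²`);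
* step (2′): summation by parts ✓`sum_inner_div_eq_sum_edges` and the Landau condition of `V` ALONE (✓`sum_im_su2Quat_eq_of_inLandauGauge`)
  give `P = −Σ_x ⟪φ_x, L(divDefect W x)⟫`, where `L : ℝ³ →+ ℍ`, `v ↦ (0, v₀, −v₁, v₂)` is the isometric reading `Im q(W') = L(imVec W')`
  (`LandauBallCoercive.im_su2Quat_eq_imVec`; the sign is the first-row convention of `su2Quat` against the second-row convention of `imVec`); hence
  `P ≤ √S·√Φ`, `Φ = landauPhi H W = Σ_x ‖L(divDefect W x)‖²` (`Real.sum_mul_le_sqrt_mul_sqrt`);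
* so `D/2 ≤ √S√Φ`, `S ≤ 8H²√S√Φ`, `S ≤ 64H⁴Φ`; and `gaugeDist g g' x = ‖ψ_x − 1‖² ≤ 2‖φ_x‖²` (✓`norm_sub_one_sq_le`), so
  `Σ_x gaugeDist ≤ 2S ≤ 128·H⁴·Φ`.

Tree (✓…LandauBall*, ✓…SmearedFPOrbit `gaugeDist`, ✓…SmearedFPWeight `landauPhi`/`divDefect`) + Mathlib; the only definition is the task's Prop
(verbatim; the reading `L` is a local `AddMonoidHom` inside the proof); standard axioms.  HONEST LABEL: a deterministic brick of step (1b) of the XL stubs S5/U5; T-S5.4 proper, S5, U5 and the cruxes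
⟨24004⟩ ⟨24335⟩ ⟨24336⟩ remain OPEN; no summit is proved; the Yang–Mills mass gap is NOT proved by this file.  Seat ym-line-sfw-p2-w5 g21.
-/

set_option autoImplicit false

noncomputable section

open Finset Quaternion
open Literature.MathematicalPhysics.QuantumFieldTheory.AxialGauge (boxEdges)
open Literature.MathematicalPhysics.QuantumLattice (su2Quat norm_su2Quat gaugeTransformZd LGConfig ZdEdge)
open Literature.Probability.LatticeModels (Site)
open Summit.QuantumFields.YangMills.Theorems.AllWindowsColdBoxBoxHighLine.LandauBall

namespace Summit.QuantumFields.YangMills.Theorems.AllWindowsColdBoxBoxHighLine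

/-! ## The task's Prop (verbatim from `TaskS5Coercive.lean`) -/

/-- **T-S5.4ℓ `LandauBallCoercivity` (M).** Quantitative Gribov uniqueness: if `U^g` is in lattice Landau gauge and both `U^g`, `U^{g'}`
(interior `g, g'`) have all cold-box links within defect `r²` of the identity, `r·H ≤ c₀`, then
`c·Σ_{x ∈ interior} gaugeDist g g' x ≤ H⁴ · landauPhi H (U^{g'})`.  (U3 is the case `landauPhi = 0`.) -/
def LandauBallCoercivity : Prop :=
  ∃ c₀ c : ℝ, 0 < c₀ ∧ 0 < c ∧ ∀ H : ℕ, 1 ≤ H → ∀ r : ℝ, 0 ≤ r → r * H ≤ c₀ →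
    ∀ (U : LGConfig 4 SU2) (g g' : Site 4 → SU2), IsInteriorGauge H g → IsInteriorGauge H g' →
      (∀ e ∈ boxEdges 4 (2 * H + 1), linkDefect (gaugeTransformZd g U) e ≤ r ^ 2) →
      (∀ e ∈ boxEdges 4 (2 * H + 1), linkDefect (gaugeTransformZd g' U) e ≤ r ^ 2) →
      InLandauGauge H (gaugeTransformZd g U) →
        c * ∑ x ∈ interiorSites H, gaugeDist g g' x ≤ (H : ℝ) ^ 4 * landauPhi H (gaugeTransformZd g' U)

namespace LandauBallCoercive

/-! ## The isometric reading `Im ∘ su2Quat = L ∘ imVec`, `L v = (0, v₀, −v₁, v₂)` -/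

/-- `Im q(W) = (0, (imVec W)₀, −(imVec W)₁, (imVec W)₂)` for `W ∈ SU(2)` (`W₀₁ = −conj W₁₀`: first-row convention of `su2Quat` against the
second-row convention of `imVec`). -/
theorem im_su2Quat_eq_imVec (W : SU2) : (su2Quat W).im = ⟨0, imVec W 0, -(imVec W 1), imVec W 2⟩ := by
  have h01 := apply_zero_one_eq_neg_conj W
  ext
  · rfl
  · simp [su2Quat, imVec]
  · simp [su2Quat, imVec, h01]
  · simp [su2Quat, imVec, h01]

/-- A purely imaginary quaternion has `‖q‖² = q₁² + q₂² + q₃²`. -/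
theorem norm_sq_of_re_eq_zero {q : ℍ} (hq : q.re = 0) : ‖q‖ ^ 2 = q.imI ^ 2 + q.imJ ^ 2 + q.imK ^ 2 := by
  rw [sq, ← Quaternion.normSq_eq_norm_mul_self, Quaternion.normSq_def', hq]
  ring

end LandauBallCoercive

open LandauBallCoercive

/-! ## The theorem -/

/-- **T-S5.4ℓ: coercivity of `landauPhi` on the gauge ball around the Landau representative** (`c₀ = 1/32`, `c = 1/128`). -/
theorem landauBallCoercivity : LandauBallCoercivity := by
  refine ⟨1 / 32, 1 / 128, by norm_num, by norm_num, ?_⟩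
  intro H hH r hr hrH U g g' hg hg' hdg hdg' hLg
  set V : LGConfig 4 SU2 := gaugeTransformZd g U with hV
  set W : LGConfig 4 SU2 := gaugeTransformZd g' U with hW
  -- the relative gauge transformation `h = g'·g⁻¹` and its quaternion field `ψ`
  set h : Site 4 → SU2 := fun x => g' x * (g x)⁻¹ with hh
  have hh1 : ∀ x, x ∉ interiorSites H → h x = 1 := fun x hx => by simp [hh, hg x hx, hg' x hx]
  have hWh : ∀ e : ZdEdge 4, W e = h e.1 * V e * (h (e.1 + Pi.single e.2 1))⁻¹ := by
    intro e
    simp only [hW, hV, hh, gaugeTransformZd]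
    group
  have hone : su2Quat (1 : SU2) = 1 := FemtoTransferGap.su2Quat_one
  set ψ : Site 4 → ℍ := fun x => su2Quat (h x) with hψ
  have hψ1 : ∀ x, x ∉ interiorSites H → ψ x = 1 := fun x hx => by simp only [hψ, hh1 x hx, hone]
  have hnorm : ∀ x, ‖ψ x‖ = 1 := fun x => norm_su2Quat _
  have hqW : ∀ e : ZdEdge 4, su2Quat (W e) = ψ e.1 * su2Quat (V e) * star (ψ (e.1 + Pi.single e.2 1)) := by
    intro e; rw [hWh e, su2Quat_mul_mul_inv]
  -- (1) link bounds on box edges, the edge bound and the sup bound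
  have hVr : ∀ e ∈ boxEdges 4 (2 * H + 1), ‖su2Quat (V e) - 1‖ ≤ r := fun e he => norm_su2Quat_sub_one_le hr (hdg e he)
  have hWr : ∀ e ∈ boxEdges 4 (2 * H + 1), ‖su2Quat (W e) - 1‖ ≤ r := fun e he => norm_su2Quat_sub_one_le hr (hdg' e he)
  have hedge : ∀ e ∈ boxEdges 4 (2 * H + 1), ‖ψ e.1 - ψ (e.1 + Pi.single e.2 1)‖ ≤ 2 * r := by
    intro e he
    have h1 := norm_sub_le_of_transform (su2Quat (V e)) (hnorm e.1) (hnorm (e.1 + Pi.single e.2 1))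
    rw [← hqW e] at h1
    linarith [hVr e he, hWr e he]
  have hsup : ∀ x, ‖ψ x - 1‖ ≤ 4 * r * H := norm_sub_one_le_of_edges hr ψ hψ1 hedge
  have hH1 : (1 : ℝ) ≤ H := by exact_mod_cast hH
  have hrH' : 4 * r * (H : ℝ) ≤ 1 / 8 := by linarith
  have hre : ∀ x, 7 / 8 ≤ (ψ x).re := fun x => by
    have h1 := one_sub_norm_le_re (ψ x)
    linarith [hsup x]
  -- (2′) the test field `φ = Im ψ`, the edge field `F`, summation by parts with the Landau condition of `V` only
  set φ : Site 4 → ℍ := fun x => (ψ x).im with hφ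
  have hφ0 : ∀ x, x ∉ interiorSites H → φ x = 0 := fun x hx => by simp only [hφ, hψ1 x hx, im_one]
  set F : ZdEdge 4 → ℍ := fun e => (su2Quat (W e)).im - (su2Quat (V e)).im with hF
  -- the additive reading `L v = (0, v₀, −v₁, v₂)` of `ℝ³` in the imaginary quaternions
  let imL : (Fin 3 → ℝ) →+ ℍ :=
    { toFun := fun v => ⟨0, v 0, -(v 1), v 2⟩
      map_zero' := by ext <;> simp
      map_add' := fun v w => by ext <;> simp; ring }
  have himL : ∀ W' : SU2, (su2Quat W').im = imL (imVec W') := fun W' => im_su2Quat_eq_imVec W'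
  have himLn : ∀ v : Fin 3 → ℝ, ‖imL v‖ ^ 2 = ∑ c : Fin 3, v c ^ 2 := fun v => by
    rw [norm_sq_of_re_eq_zero (show (imL v).re = 0 from rfl), Fin.sum_univ_three]
    show (v 0) ^ 2 + (-(v 1)) ^ 2 + (v 2) ^ 2 = _
    ring
  have hdiv : ∀ x ∈ interiorSites H, ∑ μ : Fin 4, (F (x, μ) - F (x - Pi.single μ 1, μ)) = -imL (divDefect W x) := by
    intro x hx
    have h2 := sum_im_su2Quat_eq_of_inLandauGauge hLg hx
    have hLW : imL (divDefect W x) = ∑ μ : Fin 4, ((su2Quat (W (x - Pi.single μ 1, μ))).im - (su2Quat (W (x, μ))).im) := by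
      rw [divDefect, map_sum]
      refine Finset.sum_congr rfl fun μ _ => ?_
      rw [map_sub, himL, himL]
    rw [hLW]
    simp only [hF, Finset.sum_sub_distrib] at h2 ⊢
    rw [h2]
    abel
  have hpair : ∑ e ∈ boxEdges 4 (2 * H + 1), inner ℝ (φ e.1 - φ (e.1 + Pi.single e.2 1)) (F e) =
      -∑ x ∈ interiorSites H, inner ℝ (φ x) (imL (divDefect W x)) := by
    rw [← sum_inner_div_eq_sum_edges φ hφ0 F, ← Finset.sum_neg_distrib]
    exact Finset.sum_congr rfl fun x hx => by rw [hdiv x hx, inner_neg_right]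
  -- the two sums `S = Σ ‖φ‖²`, `Φ = landauPhi H W = Σ ‖L divDefect‖²`
  set S := ∑ x ∈ interiorSites H, ‖φ x‖ ^ 2 with hS
  have hS0 : 0 ≤ S := Finset.sum_nonneg fun x _ => sq_nonneg _
  have hΦ : landauPhi H W = ∑ x ∈ interiorSites H, ‖imL (divDefect W x)‖ ^ 2 := by
    unfold landauPhi
    exact Finset.sum_congr rfl fun x _ => (himLn _).symm
  have hΦ0 : 0 ≤ landauPhi H W := landauPhi_nonneg H W
  -- Cauchy–Schwarz: `P ≤ √S √Φ`
  have hCS : ∑ e ∈ boxEdges 4 (2 * H + 1), inner ℝ (φ e.1 - φ (e.1 + Pi.single e.2 1)) (F e) ≤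
      Real.sqrt S * Real.sqrt (landauPhi H W) := by
    rw [hpair, hΦ, hS]
    calc -∑ x ∈ interiorSites H, inner ℝ (φ x) (imL (divDefect W x))
        ≤ ∑ x ∈ interiorSites H, ‖φ x‖ * ‖imL (divDefect W x)‖ := by
          rw [← Finset.sum_neg_distrib]
          exact Finset.sum_le_sum fun x _ => (neg_le_abs _).trans (abs_real_inner_le_norm _ _)
      _ ≤ Real.sqrt (∑ x ∈ interiorSites H, ‖φ x‖ ^ 2) * Real.sqrt (∑ x ∈ interiorSites H, ‖imL (divDefect W x)‖ ^ 2) :=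
          Real.sum_mul_le_sqrt_mul_sqrt _ _ _
  -- (3) the per-edge lower bound
  have hper : ∀ e ∈ boxEdges 4 (2 * H + 1),
      5 / 8 * ‖φ e.1 - φ (e.1 + Pi.single e.2 1)‖ ^ 2 - 4 * r ^ 2 * (‖φ e.1‖ ^ 2 + ‖φ (e.1 + Pi.single e.2 1)‖ ^ 2) ≤
        inner ℝ (φ e.1 - φ (e.1 + Pi.single e.2 1)) (F e) := by
    intro e he
    have h1 := edge_pairing_lower_sq (V := su2Quat (V e)) (hnorm e.1) (hnorm (e.1 + Pi.single e.2 1)) (hre _) (hre _) (hVr e he)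
    rw [← hqW e] at h1
    simpa only [hφ, hF, im_sub] using h1
  -- (4) sum, edge multiplicity, Poincaré
  have hsum := Finset.sum_le_sum hper
  rw [Finset.sum_sub_distrib, ← Finset.mul_sum, ← Finset.mul_sum] at hsum
  have hmult := sum_edges_endpoints_le (H := H) (fun x => ‖φ x‖ ^ 2) (fun x => sq_nonneg _)
    (fun x hx => by simp only [hφ0 x hx, norm_zero]; ring)
  have hP := sum_norm_sq_le_poincare (H := H) φ hφ0
  have hDD : ∑ e ∈ boxEdges 4 (2 * H + 1), ‖φ (e.1 + Pi.single e.2 1) - φ e.1‖ ^ 2 =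
      ∑ e ∈ boxEdges 4 (2 * H + 1), ‖φ e.1 - φ (e.1 + Pi.single e.2 1)‖ ^ 2 :=
    Finset.sum_congr rfl fun e _ => by rw [norm_sub_rev]
  rw [hDD] at hP
  set D := ∑ e ∈ boxEdges 4 (2 * H + 1), ‖φ e.1 - φ (e.1 + Pi.single e.2 1)‖ ^ 2 with hD
  have hD0 : 0 ≤ D := Finset.sum_nonneg fun e _ => sq_nonneg _
  have hrH2 : r ^ 2 * (H : ℝ) ^ 2 ≤ 1 / 1024 := by
    have h1 : r * (H : ℝ) ≤ 1 / 32 := hrH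
    have h2 : 0 ≤ r * (H : ℝ) := by positivity
    nlinarith
  set t := Real.sqrt S with ht
  set u := Real.sqrt (landauPhi H W) with hu
  have ht0 : 0 ≤ t := Real.sqrt_nonneg _
  have hu0 : 0 ≤ u := Real.sqrt_nonneg _
  have htS : t ^ 2 = S := Real.sq_sqrt hS0
  have huΦ : u ^ 2 = landauPhi H W := Real.sq_sqrt hΦ0
  -- (5/8) D − 32 r² S ≤ t u,  32 r² S ≤ D/8  ⇒  D/2 ≤ t u ;  S ≤ 4H²D ≤ 8H² t u  ⇒  S ≤ 64 H⁴ Φ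
  have hD8 : 5 / 8 * D - 32 * r ^ 2 * S ≤ t * u := by nlinarith [hmult, hsum, hCS, sq_nonneg r]
  have hSD : S ≤ 4 * (H : ℝ) ^ 2 * D := hP
  have h32 : 32 * r ^ 2 * S ≤ 1 / 8 * D := by nlinarith [hSD, hrH2, sq_nonneg r]
  have hD2 : 1 / 2 * D ≤ t * u := by linarith
  have hS8 : S ≤ 8 * (H : ℝ) ^ 2 * (t * u) :=
    calc S ≤ 4 * (H : ℝ) ^ 2 * D := hSD
      _ ≤ 4 * (H : ℝ) ^ 2 * (2 * (t * u)) := mul_le_mul_of_nonneg_left (by linarith) (by positivity)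
      _ = 8 * (H : ℝ) ^ 2 * (t * u) := by ring
  have hS64 : S ≤ 64 * (H : ℝ) ^ 4 * landauPhi H W := by
    have h8 : t ^ 2 ≤ 8 * (H : ℝ) ^ 2 * (t * u) := by rw [htS]; exact hS8
    have hsq : 0 ≤ (t - 8 * (H : ℝ) ^ 2 * u) ^ 2 := sq_nonneg _
    have hkey : t ^ 2 ≤ 64 * (H : ℝ) ^ 4 * u ^ 2 := by nlinarith [h8, hsq]
    rw [← htS, ← huΦ]
    exact hkey
  -- (5) `gaugeDist g g' x = ‖ψ_x − 1‖² ≤ 2 ‖φ_x‖²`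
  have hgd : ∀ x, gaugeDist g g' x ≤ 2 * ‖φ x‖ ^ 2 := by
    intro x
    have hd : gaugeDist g g' x = ‖ψ x - 1‖ ^ 2 := linkDefect_eq_norm_sq (fun _ => h x) ((0 : Site 4), (0 : Fin 4))
    rw [hd]
    exact norm_sub_one_sq_le (hnorm x) (by linarith [hre x])
  calc 1 / 128 * ∑ x ∈ interiorSites H, gaugeDist g g' x
      ≤ 1 / 128 * ∑ x ∈ interiorSites H, 2 * ‖φ x‖ ^ 2 := by
        refine mul_le_mul_of_nonneg_left (Finset.sum_le_sum fun x _ => hgd x) (by norm_num)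
    _ = 1 / 64 * S := by rw [← Finset.mul_sum]; ring
    _ ≤ (H : ℝ) ^ 4 * landauPhi H W := by linarith [hS64]

end Summit.QuantumFields.YangMills.Theorems.AllWindowsColdBoxBoxHighLine

end
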